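import Mathlib
import Summits.HodgeConjecture.FermatCycles.HodgeFermatTheoremU
import Summits.HodgeConjecture.FermatCycles.HodgeFermatTheoremUEq

/-!
# THEOREM KR6 — a coincidence of CM types at a squarefree level prime to 6 is TRIVIAL — part 1 (`HodgeFermat/TheoremKR.lean`; HF-G28)

Tree copy (part 1 of 3) of the module `HodgeFermat/TheoremKR.lean` of the sibling cell's standalone package
`run/shared/lean/pub/pub-hodgefermat/lean/HodgeFermat/` (793 lines, sha256 `b514baea4362d10e…`), source lines 50–294 (§§0–4: statements `KR6`/`KR6Multiset`/`PropL7cN`, permutations, the jointly primitive setting `PSetting`, the finite levels, STEP A/B without disjointness).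
Filed by cell `pub-hfermat`, seat prover-1 gen-3, on the COORDINATOR KEEPER RULING of 2026-08-25 (gem sweep H1: take the
off-gate kernel theorem `thmFstar` through the gate) — here THEOREM F* of `tables/DPRIME-THEOREM.md` §9 IN FULL, i.e.
PROPOSITION D′(3N) and the descent (`HodgeFermat/PropDPrimeNFinal.lean`, GATE HF-G34), the last off-gate form of THEOREM F*
(its first two forms, `DecodingFinal.thmFstar` = F* at the prime levels and `ThmFstarNFinal.thmFstar` = F*(3N), landed on
2026-08-25 as `HodgeFermatThmFstar.lean` / `HodgeFermatThmFstarN.lean`, seats prover-1 gen-0 / gen-2); this file is one link of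
the import closure of `PropDPrimeNFinal.propDprime` (the sibling's KR-free chain: THEOREM L, COROLLARY M, THEOREM D6,
THEOREM U⁺, THEOREM KR6, THEOREM Z3U) on top of those landed chains.  The source module is the sibling's hub-checked module of
record (pub-hodgefermat `CERT.md` l.927, GATE HF-G28); its declarations are copied VERBATIM.
Deviations from the source module, exhaustively: the `import` lines (tree modules `Summits.HodgeConjecture.FermatCycles.
HodgeFermat*` instead of `HodgeFermat.*`); this module docstring; the four re-binding lines `open HodgeFermat.KRFree.Decoding renaming st_symm → sameType_symm, st_trans → sameType_trans, st_swap → sameType_swap, st_rot → sameType_rot, unit_mul_not_dvd → not_dvd_unit_mul` / `open HodgeFermat.KRFree.Decoding (rsum_swap rsum_rot)` / `open HodgeFermat.KRFree.TheoremZ3U renaming not_dvd_cofactor' → not_dvd_cofactor, rsum_const₃ → rsum_const_of_dvd` / `open HodgeFermat.KRFree.PropZ5 (mul_mod_mod)` are added after the source's `open` lines (the module used the deleted `Bridge`/`TheoremD6`/`TheoremU` copies); one-line docstrings added (gate lint) to `perm3_symm`, `PSetting.pos`, `PSetting.one_lt`, `PSetting.odd`, `PSetting.hsum`, `PSetting.hsum'`,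 `fact_contraP`; the file ends at source l.294 with an `end` line (parts 2, 3 = `HodgeFermatTheoremKRB/C.lean`).
Every other line — in particular every declaration's statement and proof — is byte-identical to the source.
HONEST FRAMING: explicit algebraic cycles for specific Hodge classes on Fermat/Delsarte varieties; residual open instances
listed; no claim on general Hodge.  (This file is arithmetic of CM types / finite combinatorics / analytic number theory
of the sibling's KR-free programme; it claims nothing about cycles.)

The source module's docstring (TheoremKR.lean l.7–48), verbatim:

## THEOREM KR6 — a coincidence of CM types at a squarefree level prime to 6 is TRIVIAL (HF-G28)

THEOREM D6 (`TheoremD6.lean` … `D6OneFile.lean`, generations 21–24) is the DISJOINT case of the Koblitz–Rohrlich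
coincidence theorem at the squarefree levels prime to 6: two triples `T = (a, b, c)`, `T' = (a', b', c')` of level `N`
(`N ∣ a + b + c`, no entry `≡ 0`) with the same CM type and with NO entry of `T` congruent to an entry of `T'` do not
exist.  The case left open there — and imported so far from Aoki–Shioda's (𝔅²_m)(i) in COROLLARY D6′ of
`tables/KR-FREE.md` §7 / THEOREM C⁻ of `tables/SEMI-THEOREM.md` §3 — is the SHARED configuration: `T` and `T'` have a
common entry.  Generation 27 settled it for ALL-UNIT triples at every odd level (`TheoremUShared.lean`).  THIS module
settles it for ARBITRARY triples (entries divisible by primes of the level allowed) at every squarefree level prime to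
6, and so puts the full conclusion of Koblitz–Rohrlich's Theorem 1 there into the kernel with no imported input:

* `KR6` / `kr6_of_W : HypW → KR6` — **at a squarefree level `N` prime to 6, two triples of level `N` with the same CM
  type are permutations of each other as residues mod `N`** (`Perm3`; multiset form `KR6Multiset`), from LEMMA W at the
  squarefree levels prime to 6 (`TheoremU.HypW`, a theorem since generation 23, used through generation 24's one-elaboration
  form `OneFile.hypW` of `D6OneFile.lean`; the no-binder form `kr6 : KR6` is `TheoremKRFinal.lean`);
* `d6_of_kr6 : KR6 → D6` (THEOREM D6 is the disjoint case).

PROOF.  Divide out the common divisor of the level and the six entries (strong induction, `sameType_descend`), so that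
the pair is jointly primitive (`PSetting`: the setting of `TheoremD6.lean` WITHOUT disjointness).  If the pair is
disjoint, THEOREM D6.  Otherwise permute so that `a ≡ a' (mod N)`; if `{b, c} ≡ {b', c'}` we are done, else
(`key`) the four WINGS `b, c, b', c'` satisfy `b ≢ b', c'` and `c ≢ b', c'`, and (`shared_false`):
(1) every wing is a unit mod `N` (`wing_coprime`): a prime `q` of `N` dividing the wing `b` either divides `a` too —
    then `T` is a Z3 triple at `q`, impossible against any `T'` (`noZ3P`: rows (Z3,U), (Z3,Z1) of THEOREM L, joint
    primitivity) — or makes `T` a Z1 triple at `q` with `q`-multiple `b`, and then `b ≢ a'` as well (`q ∤ a ≡ a'`), so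
    `b` is congruent to NO entry of `T'`, which is all the prime-by-prime analysis of `TheoremD6.lean` ever used of
    disjointness: rows (U,Z1) (`no_UZ1_ge7P`), (Z1,Z1) at `q ≥ 11` (`row_Z1Z1_eleven` needs only `ȳ ≠ ȳ'`), (Z1,Z1) at
    `7` (PROPOSITION L7(c) re-proved here as `propL7cN` with the single non-congruence `7y ≢ 7y' (mod 7n)` in place of
    disjointness — its generation-22 proof used nothing more), and at the prime `5` PROPOSITIONS Z5 / L5 (`propZ5` needs
    only `x₁ ≢ y₁`) and the facts F5 … F95 (`fact_contraP`);
(2) with all wings units (the shared entry `a` need not be one), LEMMA W at `N` applied to the odd weight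
    `w = 1_T − 1_{T'} − 1_{−T} + 1_{−T'}` — in which the `±a`-terms CANCEL, so that `w` lives on the eight unit residues
    `±b, ±c, ±b', ±c'` — gives `w = 0` (its residue transform vanishes: the carries of `T` and `T'` agree at every unit,
    `rsum_eq_of_sameType`, and `⟨ta⟩ = ⟨ta'⟩`), and evaluating `w` at `b` gives `b ∈ {b', c'}` (`shared_wings`; `b ≡ −c`
    would force `N ∣ a`) — a contradiction.

LIGHT module: imports `TheoremU` (LEMMA W, the weight `wt`, THEOREM D6 from `HypW`) and `TheoremUEq` (`Perm3`, the
multiset form) only.  Hub record `check/KR6_standalone.lean` (the 13 bodies of `check/TheoremU_standalone.lean` +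
`TheoremUEq.lean` + this file; `--axioms HodgeFermat.KRFree.TheoremKR.kr6_of_W` = the three) and the link check
`check/KR6Link_standalone.lean` (`OneFile.hypW` postulated).  No `sorry`, no `native_decide`.
`tables/KR-FREE.md` §7 (COROLLARY D6′ is now free of Aoki–Shioda), `tables/SEMI-THEOREM.md` §3, paper §1 (xiv).
-/

set_option autoImplicit false

namespace HodgeFermat.KRFree.TheoremKR

open Finset HodgeFermat.KRFree HodgeFermat.KRFree.LemmaN HodgeFermat.KRFree.LemmaO HodgeFermat.KRFree.TheoremL
  HodgeFermat.KRFree.Bridge HodgeFermat.KRFree.TheoremD6 HodgeFermat.KRFree.PropL7c HodgeFermat.KRFree.TheoremU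
open HodgeFermat.KRFree.TheoremUEq (Perm3 zmod_multiset_eq)

open HodgeFermat.KRFree.Decoding renaming st_symm → sameType_symm, st_trans → sameType_trans, st_swap → sameType_swap, st_rot → sameType_rot, unit_mul_not_dvd → not_dvd_unit_mul
open HodgeFermat.KRFree.Decoding (rsum_swap rsum_rot)
open HodgeFermat.KRFree.TheoremZ3U renaming not_dvd_cofactor' → not_dvd_cofactor, rsum_const₃ → rsum_const_of_dvd
open HodgeFermat.KRFree.PropZ5 (mul_mod_mod)

/-! ## Statements -/

/-- **THEOREM KR6**: at a squarefree level `N` prime to `6`, two triples `(a, b, c)`, `(a', b', c')` of level `N`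
(entry sums divisible by `N`, no entry divisible by `N`) with the same CM type (`SameType`: `H_T ∩ (ℤ/N)ˣ =
H_{T'} ∩ (ℤ/N)ˣ`) are permutations of each other as residues mod `N`. -/
def KR6 : Prop :=
  ∀ N a b c a' b' c' : ℕ, Squarefree N → ¬ 2 ∣ N → ¬ 3 ∣ N →
    N ∣ a + b + c → N ∣ a' + b' + c' →
    ¬ N ∣ a → ¬ N ∣ b → ¬ N ∣ c → ¬ N ∣ a' → ¬ N ∣ b' → ¬ N ∣ c' →
    SameType N (a, b, c) (a', b', c') → Perm3 (a % N) (b % N) (c % N) (a' % N) (b' % N) (c' % N)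

/-- THEOREM KR6 as an equality of multisets in `ℤ/N`: `{a, b, c} = {a', b', c'}`. -/
def KR6Multiset : Prop :=
  ∀ N a b c a' b' c' : ℕ, Squarefree N → ¬ 2 ∣ N → ¬ 3 ∣ N →
    N ∣ a + b + c → N ∣ a' + b' + c' →
    ¬ N ∣ a → ¬ N ∣ b → ¬ N ∣ c → ¬ N ∣ a' → ¬ N ∣ b' → ¬ N ∣ c' →
    SameType N (a, b, c) (a', b', c') →
    ({(a : ZMod N), (b : ZMod N), (c : ZMod N)} : Multiset (ZMod N)) =
      {(a' : ZMod N), (b' : ZMod N), (c' : ZMod N)}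

/-! ## Permutations of `Perm3` -/

section perm
variable {α : Type*} {A B C A' B' C' : α}

/-- `Perm3` is symmetric -/
lemma perm3_symm (h : Perm3 A B C A' B' C') : Perm3 A' B' C' A B C := by
  rcases h with ⟨rfl, rfl, rfl⟩ | ⟨rfl, rfl, rfl⟩ | ⟨rfl, rfl, rfl⟩ | ⟨rfl, rfl, rfl⟩ |
    ⟨rfl, rfl, rfl⟩ | ⟨rfl, rfl, rfl⟩ <;> simp [Perm3]

/-- swap the first two entries of the first triple -/
lemma perm3_swap12 (h : Perm3 A B C A' B' C') : Perm3 B A C A' B' C' := by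
  rcases h with ⟨rfl, rfl, rfl⟩ | ⟨rfl, rfl, rfl⟩ | ⟨rfl, rfl, rfl⟩ | ⟨rfl, rfl, rfl⟩ |
    ⟨rfl, rfl, rfl⟩ | ⟨rfl, rfl, rfl⟩ <;> simp [Perm3]

/-- rotate the first triple: `(A, B, C) ↦ (C, A, B)` -/
lemma perm3_rot (h : Perm3 A B C A' B' C') : Perm3 C A B A' B' C' := by
  rcases h with ⟨rfl, rfl, rfl⟩ | ⟨rfl, rfl, rfl⟩ | ⟨rfl, rfl, rfl⟩ | ⟨rfl, rfl, rfl⟩ |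
    ⟨rfl, rfl, rfl⟩ | ⟨rfl, rfl, rfl⟩ <;> simp [Perm3]

/-- swap the first two entries of the second triple -/
lemma perm3_swap12' (h : Perm3 A B C A' B' C') : Perm3 A B C B' A' C' :=
  perm3_symm (perm3_swap12 (perm3_symm h))

/-- rotate the second triple: `(A', B', C') ↦ (C', A', B')` -/
lemma perm3_rot' (h : Perm3 A B C A' B' C') : Perm3 A B C C' A' B' :=
  perm3_symm (perm3_rot (perm3_symm h))

end perm

/-! ## The jointly primitive setting WITHOUT disjointness -/

/-- the standing hypotheses on a pair of triples at level `N`, jointly primitive case — `TheoremD6.Setting` without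
its disjointness field -/
structure PSetting (N : ℕ) (T T' : ℕ × ℕ × ℕ) : Prop where
  sq : Squarefree N
  two : ¬ 2 ∣ N
  three : ¬ 3 ∣ N
  sum : N ∣ T.1 + T.2.1 + T.2.2
  sum' : N ∣ T'.1 + T'.2.1 + T'.2.2
  nz₁ : ¬ N ∣ T.1
  nz₂ : ¬ N ∣ T.2.1
  nz₃ : ¬ N ∣ T.2.2
  nz₁' : ¬ N ∣ T'.1
  nz₂' : ¬ N ∣ T'.2.1
  nz₃' : ¬ N ∣ T'.2.2
  jp : JP N T T'
  same : SameType N T T'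

namespace PSetting

variable {N a b c a' b' c' : ℕ}

/-- the level of a `PSetting` is positive -/
lemma pos (S : PSetting N (a, b, c) (a', b', c')) : 0 < N :=
  Nat.pos_of_ne_zero (fun h => by subst h; exact not_squarefree_zero S.sq)

/-- the level of a `PSetting` exceeds 1 -/
lemma one_lt (S : PSetting N (a, b, c) (a', b', c')) : 1 < N := by
  have h0 := S.pos
  by_contra h
  have h1 : N = 1 := by omega
  exact S.nz₁ (by rw [h1]; exact one_dvd _)

/-- the level of a `PSetting` is odd -/
lemma odd (S : PSetting N (a, b, c) (a', b', c')) : Odd N :=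
  Nat.odd_iff.mpr (by have := S.two; omega)

/-- the first triple of a `PSetting` is zero-sum -/
lemma hsum (S : PSetting N (a, b, c) (a', b', c')) : N ∣ a + b + c := S.sum
/-- the second triple of a `PSetting` is zero-sum -/
lemma hsum' (S : PSetting N (a, b, c) (a', b', c')) : N ∣ a' + b' + c' := S.sum'

/-- interchange the two triples -/
lemma symm (S : PSetting N (a, b, c) (a', b', c')) : PSetting N (a', b', c') (a, b, c) where
  sq := S.sq
  two := S.two
  three := S.three
  sum := S.sum'
  sum' := S.sum
  nz₁ := S.nz₁'
  nz₂ := S.nz₂'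
  nz₃ := S.nz₃'
  nz₁' := S.nz₁
  nz₂' := S.nz₂
  nz₃' := S.nz₃
  jp := fun q hq hqN h1 h2 h3 h4 h5 h6 => S.jp q hq hqN h4 h5 h6 h1 h2 h3
  same := sameType_symm S.same

/-- swap the first two entries of the first triple -/
lemma swap12 (S : PSetting N (a, b, c) (a', b', c')) : PSetting N (b, a, c) (a', b', c') where
  sq := S.sq
  two := S.two
  three := S.three
  sum := by have h := S.hsum; rwa [show a + b + c = b + a + c by ring] at h
  sum' := S.sum'
  nz₁ := S.nz₂
  nz₂ := S.nz₁
  nz₃ := S.nz₃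
  nz₁' := S.nz₁'
  nz₂' := S.nz₂'
  nz₃' := S.nz₃'
  jp := fun q hq hqN h1 h2 h3 h4 h5 h6 => S.jp q hq hqN h2 h1 h3 h4 h5 h6
  same := by
    have hs : N ∣ b + a + c := by have h := S.hsum; rwa [show a + b + c = b + a + c by ring] at h
    exact sameType_trans (sameType_swap S.pos hs S.nz₃) S.same

/-- rotate the first triple: bring its last entry to the front -/
lemma rot (S : PSetting N (a, b, c) (a', b', c')) : PSetting N (c, a, b) (a', b', c') where
  sq := S.sq
  two := S.two
  three := S.three
  sum := by have h := S.hsum; rwa [show a + b + c = c + a + b by ring] at h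
  sum' := S.sum'
  nz₁ := S.nz₃
  nz₂ := S.nz₁
  nz₃ := S.nz₂
  nz₁' := S.nz₁'
  nz₂' := S.nz₂'
  nz₃' := S.nz₃'
  jp := fun q hq hqN h1 h2 h3 h4 h5 h6 => S.jp q hq hqN h2 h3 h1 h4 h5 h6
  same := sameType_trans (sameType_symm (sameType_rot S.pos S.hsum S.nz₂ S.nz₃)) S.same

/-- swap the first two entries of the second triple -/
lemma swap12' (S : PSetting N (a, b, c) (a', b', c')) : PSetting N (a, b, c) (b', a', c') :=
  S.symm.swap12.symm

/-- rotate the second triple -/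
lemma rot' (S : PSetting N (a, b, c) (a', b', c')) : PSetting N (a, b, c) (c', a', b') :=
  S.symm.rot.symm

end PSetting

/-! ## The finite levels F5 … F95, for a first entry congruent to no entry of the other triple -/

/-- a `PSetting` at a coincidence-free level with a non-shared first entry is contradictory -/
lemma fact_contraP {N a b c a' b' c' : ℕ} (hF : CoincidenceFree N) (S : PSetting N (a, b, c) (a', b', c'))
    (hno : NotIn N a (a', b', c')) : False := by
  rcases coincidenceFree_first hF S.pos a b c a' b' c' S.hsum S.hsum' S.nz₁ S.nz₂ S.nz₃ S.nz₁' S.nz₂'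
    S.nz₃' S.same with h | h | h
  · exact hno.1 h
  · exact hno.2.1 h
  · exact hno.2.2 h

/-- the levels `N = 5n ≤ 100` of the setting are `5, 35, 55, 65, 85, 95`, all coincidence-free in the kernel -/
lemma small5P {n a b c a' b' c' : ℕ} (S : PSetting (5 * n) (a, b, c) (a', b', c'))
    (hno : NotIn (5 * n) a (a', b', c')) (hn : n ≤ 20) : False := by
  interval_cases n
  · exact absurd S.pos (by norm_num)
  · exact fact_contraP F5 S hno
  · exact S.two (by norm_num)
  · exact S.three (by norm_num)
  · exact S.two (by norm_num)
  · exact absurd (Nat.isUnit_iff.mp (S.sq 5 (by norm_num))) (by norm_num)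
  · exact S.two (by norm_num)
  · exact fact_contraP F35 S hno
  · exact S.two (by norm_num)
  · exact S.three (by norm_num)
  · exact S.two (by norm_num)
  · exact fact_contraP F55 S hno
  · exact S.two (by norm_num)
  · exact fact_contraP F65 S hno
  · exact S.two (by norm_num)
  · exact S.three (by norm_num)
  · exact S.two (by norm_num)
  · exact fact_contraP F85 S hno
  · exact S.two (by norm_num)
  · exact fact_contraP F95 S hno
  · exact S.two (by norm_num)

/-! ## STEP A / B of `TheoremD6.lean` without disjointness -/

/-- no prime of `N` divides all three entries of the first triple (joint primitivity; rows (Z3,U), (Z3,Z1)) -/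
lemma noZ3P {N a b c a' b' c' : ℕ} (S : PSetting N (a, b, c) (a', b', c')) {q : ℕ} (hq : q.Prime)
    (hqN : q ∣ N) (ha : q ∣ a) (hb : q ∣ b) (hc : q ∣ c) : False := by
  have hodd := S.odd
  have h3N := S.three
  obtain ⟨n, rfl⟩ := hqN
  have hn0 : 0 < n := pos_right S.pos
  have hqn : ¬ q ∣ n := not_dvd_cofactor hq S.sq
  have hoddn : Odd n := (Nat.odd_mul.mp hodd).2
  have h3n : ¬ 3 ∣ n := fun h => h3N (Dvd.dvd.mul_left h q)
  have hne : ¬ (q ∣ a' ∧ q ∣ b' ∧ q ∣ c') :=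
    fun h => S.jp q hq (dvd_mul_right q n) ha hb hc h.1 h.2.1 h.2.2
  obtain ⟨a₁, rfl⟩ := ha
  obtain ⟨b₁, rfl⟩ := hb
  obtain ⟨c₁, rfl⟩ := hc
  by_cases h7 : 7 ≤ q
  · exact z3_vs_any q n a₁ b₁ c₁ a' b' c' hq h7 hqn hn0 hoddn S.hsum' hne S.nz₁' S.nz₂' S.nz₃' S.same
  · have hq5 : q = 5 := by
      by_contra h5
      exact h7 (seven_le_prime hq (dvd_mul_right q n) hodd h3N h5)
    subst hq5
    exact z3_vs_any5 n a₁ b₁ c₁ a' b' c' hqn hn0 hoddn h3n S.hsum' hne S.nz₁' S.nz₂' S.nz₃' S.same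

/-- (Z1, U) at a prime `q ≥ 7`: `row_UZ1_ge_eleven_not3` (`q ≥ 11`), `row_UZ1_seven_not3` (`q = 7`) -/
lemma no_UZ1_ge7P {N a b c a' b' c' : ℕ} (S : PSetting N (a, b, c) (a', b', c')) {q : ℕ} (hq : q.Prime)
    (h7 : 7 ≤ q) (hqN : q ∣ N) (ha : q ∣ a) (hb : ¬ q ∣ b) (hc : ¬ q ∣ c)
    (ha' : ¬ q ∣ a') (hb' : ¬ q ∣ b') (hc' : ¬ q ∣ c') : False := by
  have hodd := S.odd
  have h3N := S.three
  have hjp := S.jp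
  obtain ⟨n, rfl⟩ := hqN
  have hn0 : 0 < n := pos_right S.pos
  have hqn : ¬ q ∣ n := not_dvd_cofactor hq S.sq
  have hoddn : Odd n := (Nat.odd_mul.mp hodd).2
  have h3n : ¬ 3 ∣ n := fun h => h3N (Dvd.dvd.mul_left h q)
  have hsqn : Squarefree n := Squarefree.squarefree_of_dvd (dvd_mul_left n q) S.sq
  obtain ⟨y, rfl⟩ := ha
  have hy : ¬ n ∣ y := fun h => S.nz₁ (Nat.mul_dvd_mul_left q h)
  by_cases h11 : 11 ≤ q
  · exact row_UZ1_ge_eleven_not3 q n y b c a' b' c' hq h11 hqn hn0 hoddn h3n S.hsum hb hc S.hsum'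
      ha' hb' hc' hy S.same
  · have hq7 : q = 7 := by
      have hlt : q < 11 := by omega
      interval_cases q
      · rfl
      · exact absurd hq (by norm_num)
      · exact absurd hq (by norm_num)
      · exact absurd hq (by norm_num)
    subst hq7
    exact row_UZ1_seven_not3 n y b c a' b' c' hsqn hqn h3n hn0 hoddn S.hsum hb hc S.hsum' ha' hb' hc'
      hy (gcd_chain_eq_one hjp) S.same


end HodgeFermat.KRFree.TheoremKR
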